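import Summits.QuantumFields.YangMills.Theorems.BalabanUVNodesN15TorusPeriodisationDeltaA
import Summits.QuantumFields.YangMills.Theorems.BalabanUVNodesN15NeumannCubeMajorant
import Literature.MathematicalPhysics.QuantumFieldTheory.Balaban1983to89.B6Prop26ReachTransplant
import HarnessLib

/-!
# Route «BalabanUVNodes» (K3⁷), node N15 = NE2, -a lane, PROGRAMME P file P-IIa: THE NEUMANN CUBE PROPAGATOR OF PROGRAMME N LIFTED TO THE TORUS FAMILY OF RECORD —
# cube side `L^s` FIXED, volume `M_ν = 2L^{m_T}` FREE — with EXACT per-cube locality and the (2.133)-shaped gluing letter, constants UNIFORM in the volume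

Cell `pub-ymgap`, seat `pub-ymgap-dag-n15-a` (KNIT-BY-NAME, g20; D-0062; chair R424 venue; `bears_on: R4∕N15`); `--kind proof --supports stmt-QuantumFields-20544 --as helper`.
Sequel of P-Ia∕P-Ib (`…N15TorusPeriodisation(DeltaA)`: `torRed`, `pullVR`, `deltaOp_comp_pullVR`, `gOp_comp_pullVR`) and of programme N (N-IIIa `…NeumannCubePropagator`: `neumannCubeG`,
`intBonds`∕`chiInt`, `mulOp_chi_deltaOp_neumannCubeG`; N-IIIb `…NeumannCubeMajorant`: `cubeBlocks`∕`chiCube`, `hasMaj_chiCube_neumannCubeG`).  CONSUMER: dag-n15-c's two-spacing gluing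
(`…TwoSpacingGluingCubes` FILE 45 `hloc`∕`hasMaj_glued_of_cubes`, `…TwoSpacingGluingCutRows` `hasMaj_(idef_)glued_of_cutRows`), so far run on the DOUBLED torus (their INTENT-66).

WHY∕WHAT.  Programme N's cube propagator `G(□) = Sym ∘ G ∘ χ°` lives on the doubled torus `M′_ν = 2S`; the background-live gluing needs cubes of FIXED side on tori of ANY
volume ([Balaban1985BackgroundPropagators] (3.35)).  Print builds cube operators on a small torus and reads them on the big one ([Balaban1984PropagatorsII] p. 238 «identify [□̃³]
with a torus `T_□`, imposing periodicity conditions», (2.90)–(2.91) p. 239).  THE LIFT on `Tor (fine n M)`, `M′ ∣ M`: `G^{↑}(□ + c) := π^* ∘ G(□′ + π̃c) ∘ ρ_{W,π}` (§8 `liftCubeG`;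
`ρ` = the lit's `restrictOp` on the cube's bonds `cubeW`, §7).  Since `Δ_a` DESCENDS along `π` (P-Ib, Landau term included) the locality `M_h ∘ Δ_a ∘ G^{↑}(□) = M_h` is EXACT
(★★★ `mulOp_comp_deltaOp_comp_liftCubeG`; no (2.92)-type transport defect); since `π` is injective on the cube (`torRed_injOn_cubePts`) and reads its torus distance exactly
(★★ `tdistT_torRed_eq`), every two-sided-cut block majorant transfers (★★ `hasMaj_transplant_of_blockMap`, the cut lift being the lit's `transplant`: ★ `mulOp_chiCube_comp_liftCubeG`).
The sequel P-IIb instantiates this on the family of record `MP (paramsOf d L m_T K hL)` with cube torus `MP (paramsOf d L s K hL)`, `s ≤ m_T`: dag-n15-c's `hGc`∕`hloc`∕gradient∕nonlocal rows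
for `G^{↑}(□ + c)` with programme N's constants, UNIFORM in `m_T ≥ s`.
HONEST FRAMING.  Count-neutral; finite lattice geometry + block-majorant bookkeeping over LANDED rows (no new analytic estimate: the letter is N-IIIb's, i.e. [B5] Prop. 1.2 (1.110) through
the method of images); `U ≡ 1` torus MODEL of [B5] §1; the lifted operator's output is the `2L^s`-periodic images extension (only its cut rows are physical — exactly what the gluing
consumes); nothing of [B6] (2.38)–(2.40)∕[B9] asserted; NE2⁺ NOT PRINTED; N15 NOT discharged (object-bound); counts UNMOVED (typed 28∕28 · discharged 5∕27); finite tori at fixed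
lattice spacing — NOT continuum ∕ ℝ⁴ ∕ OS ∕ mass gap ∕ Clay.  Plumbing defs are DATA (`redBond`, `cubeW`, `liftCubeG`); every theorem is [folklore] lattice algebra ∕ bookkeeping about printed objects.
-/

noncomputable section

open scoped BigOperators Matrix
open Finset

namespace Summit.QuantumFields.YangMills.BalabanUVNodes.N15.TwoGrid

open Literature.MathematicalPhysics.QuantumFieldTheory.Balaban1983to89
open Literature.MathematicalPhysics.QuantumFieldTheory.Balaban1983to89.B5Prop11Plancherel (Tor fine unitVec)
open Literature.MathematicalPhysics.QuantumFieldTheory.Balaban1983to89.B5Block118 (tstep up upHom iota bpt)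
open Literature.MathematicalPhysics.QuantumFieldTheory.Balaban1983to89.B5SiteBridgeP12 (MP)

variable {d : ℕ}

/-! ## §7 The cube under the periodisation: blocks, injectivity on the cube, interior bonds, distances -/

section CubeRed

open Literature.MathematicalPhysics.QuantumFieldTheory.Balaban1983to89.B6Prop26Gluing (mulOp mulOp_apply ind ind_nonneg ind_le_one)
open Literature.MathematicalPhysics.QuantumFieldTheory.Balaban1983to89.B6Prop26ReachTransplant (restrictOp extendOp transplant restrictOp_apply restrictOp_apply_of_injOn
  restrictOp_apply_of_not_mem extendOp_apply transplant_apply)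
open Literature.MathematicalPhysics.QuantumFieldTheory.King1986.Torus (blockOf tdistT toSite)
open Literature.MathematicalPhysics.QuantumFieldTheory.Balaban1983to89.B11SectG (BlockNorm HasMaj)
open Literature.MathematicalPhysics.QuantumFieldTheory.Balaban1983to89.B4Sect5Torus (ccoord tdist)
open Literature.MathematicalPhysics.QuantumFieldTheory.Balaban1983to89.B4TorusKernel
open Literature.MathematicalPhysics.QuantumFieldTheory.Balaban1983to89.B4TorusKernel.MultiPeriod

variable (n : ℕ) [NeZero n] {M M' : Fin (d + 1) → ℕ} [∀ μ, NeZero (M μ)] [∀ μ, NeZero (M' μ)] (hM : ∀ μ, M' μ ∣ M μ) (c : Tor M) (S : ℕ)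

/-- the periodisation of BONDS: `(x, μ) ↦ (πx, μ)`. [folklore] -/
def redBond (b : Tor (fine n M) × Fin (d + 1)) : Tor (fine n M') × Fin (d + 1) := (torRed (fine_dvd n hM) b.1, b.2)

/-- THE CUBE's BONDS (the window of the lift): base point in a block of `□ + c`. [cite: Balaban1984PropagatorsII, (2.37) p.229 (the cubes of the cover)] -/
def cubeW : Finset (Tor (fine n M) × Fin (d + 1)) := Finset.univ.filter fun b => blockOf n M b.1 ∈ cubeBlocks M c S

variable {n hM c S}

omit [∀ μ, NeZero (M' μ)] in
/-- membership in the cube's bonds, unfolded. [folklore] -/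
theorem mem_cubeW (b : Tor (fine n M) × Fin (d + 1)) : b ∈ cubeW n c S ↔ blockOf n M b.1 ∈ cubeBlocks M c S := by
  simp [cubeW]

omit [∀ μ, NeZero (M' μ)] in
/-- the cube indicator on bonds IS the indicator of the window. [folklore] -/
theorem chiCube_eq_ite (b : Tor (fine n M) × Fin (d + 1)) : chiCube M n c S b = if b ∈ cubeW n c S then 1 else 0 := by
  unfold chiCube; simp only [mem_cubeW]

/-- ★ King's unit block commutes with the periodisation: `B(πx) = π̃(B(x))`. [cite: King1986, p.664 (blocks B^k(x))] -/
theorem kingBlockOf_torRed (x : Tor (fine n M)) : blockOf n M' (torRed (fine_dvd n hM) x) = torRed hM (blockOf n M x) := by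
  obtain ⟨⟨y, j⟩, rfl⟩ := (B5Blocks16.bpt_bijective n M).2 x
  show blockOf n M' (torRed (fine_dvd n hM) (bpt n M y j)) = torRed hM (blockOf n M (bpt n M y j))
  rw [torRed_bpt n hM, DefectKernel.kingBlockOf_bpt, DefectKernel.kingBlockOf_bpt]

/-- small coordinates keep their value under reduction: `val (πz)_ν = val z_ν` if `val z_ν < N′_ν`. [folklore] -/
theorem val_torRed_of_lt {N N' : Fin (d + 1) → ℕ} [∀ μ, NeZero (N μ)] [∀ μ, NeZero (N' μ)] (hN : ∀ μ, N' μ ∣ N μ) (z : Tor N) (ν : Fin (d + 1))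
    (h : (z ν).val < N' ν) : (torRed hN z ν).val = (z ν).val := by
  rw [torRed_apply, ZMod.castHom_apply]; exact ZMod.val_cast_eq_val_of_lt h

/-- ★ the cube's blocks go to the image cube's blocks: `y ∈ □ + c ⟹ π̃y ∈ □ + π̃c` (side `S ≤ M′_ν`). [folklore] -/
theorem torRed_mem_cubeBlocks (hS : ∀ ν, S ≤ M' ν) {y : Tor M} (hy : y ∈ cubeBlocks M c S) : torRed hM y ∈ cubeBlocks M' (torRed hM c) S := by
  rw [mem_cubeBlocks] at hy ⊢
  intro ν
  have h := hy ν
  have e := congrFun (torRed_sub hM y c) ν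
  rw [Pi.sub_apply] at e
  rw [← e, val_torRed_of_lt hM (y - c) ν (lt_of_lt_of_le h (hS ν))]
  exact h

/-- ★ `π̃` IS INJECTIVE ON THE CUBE's BLOCKS (side `S ≤ M′_ν`). [folklore] -/
theorem torRed_injOn_cubeBlocks (hS : ∀ ν, S ≤ M' ν) : Set.InjOn (torRed hM) (cubeBlocks M c S : Set (Tor M)) := by
  intro y hy z hz hyz
  rw [Finset.mem_coe, mem_cubeBlocks] at hy hz
  have h : y - c = z - c := by
    funext ν
    apply ZMod.val_injective
    rw [← val_torRed_of_lt hM (y - c) ν (lt_of_lt_of_le (hy ν) (hS ν)), ← val_torRed_of_lt hM (z - c) ν (lt_of_lt_of_le (hz ν) (hS ν)), torRed_sub, torRed_sub, hyz]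
  exact sub_left_injective h

/-- ★ `π` IS INJECTIVE ON THE CUBE's POINTS. [folklore] -/
theorem torRed_injOn_cubePts (hS : ∀ ν, S ≤ M' ν) {x x' : Tor (fine n M)} (hx : blockOf n M x ∈ cubeBlocks M c S) (hx' : blockOf n M x' ∈ cubeBlocks M c S)
    (h : torRed (fine_dvd n hM) x = torRed (fine_dvd n hM) x') : x = x' := by
  obtain ⟨a, ha⟩ := exists_eq_bpt_blockOf M n x
  obtain ⟨a', ha'⟩ := exists_eq_bpt_blockOf M n x'
  rw [ha, ha', torRed_bpt n hM, torRed_bpt n hM] at h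
  have hinj := B5Blocks16.bpt_injective n M' (a₁ := (torRed hM (blockOf n M x), a)) (a₂ := (torRed hM (blockOf n M x'), a')) h
  simp only [Prod.mk.injEq] at hinj
  have hy : blockOf n M x = blockOf n M x' := torRed_injOn_cubeBlocks hS (Finset.mem_coe.mpr hx) (Finset.mem_coe.mpr hx') hinj.1
  rw [ha, ha', hy, hinj.2]

/-- ★ the bond reduction is injective on the cube's bonds (the window of the transplant). [folklore] -/
theorem redBond_injOn_cubeW (hS : ∀ ν, S ≤ M' ν) : Set.InjOn (redBond n hM) (cubeW n c S : Set (Tor (fine n M) × Fin (d + 1))) := by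
  intro b hb b' hb' h
  rw [Finset.mem_coe, mem_cubeW] at hb hb'
  have h1 := congrArg Prod.fst h
  have h2 := congrArg Prod.snd h
  exact Prod.ext (torRed_injOn_cubePts (hM := hM) hS hb hb' h1) h2

/-- the window's bonds go to the image cube's bonds: `χ_{□′}(π b) = 1` for `b ∈ W`. [folklore] -/
theorem chiCube_redBond_of_mem (hS : ∀ ν, S ≤ M' ν) {b : Tor (fine n M) × Fin (d + 1)} (hb : b ∈ cubeW n c S) : chiCube M' n (torRed hM c) S (redBond n hM b) = 1 := by
  rw [mem_cubeW] at hb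
  unfold chiCube
  rw [if_pos]
  show blockOf n M' (torRed (fine_dvd n hM) b.1) ∈ _
  rw [kingBlockOf_torRed]; exact torRed_mem_cubeBlocks hS hb

/-- ★ INTERIOR BONDS GO TO INTERIOR BONDS: `b ∈ χ°(□ + c) ⟹ πb ∈ χ°(□′ + π̃c)` (`S ≤ M′_ν`). [folklore] -/
theorem redBond_mem_intBonds (hS : ∀ ν, S ≤ M' ν) {b : Tor (fine n M) × Fin (d + 1)} (hb : b ∈ intBonds M n c S) : redBond n hM b ∈ intBonds M' n (torRed hM c) S := by
  rw [mem_intBonds] at hb ⊢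
  have hval : ∀ ν, (torRed (fine_dvd n hM) b.1 ν - up n M' (torRed hM c) ν).val = (b.1 ν - up n M c ν).val := by
    intro ν
    rw [← torRed_up n hM, ← Pi.sub_apply, ← torRed_sub]
    refine val_torRed_of_lt (fine_dvd n hM) (b.1 - up n M c) ν (lt_of_lt_of_le (hb.1 ν) ?_)
    show S * n ≤ n * M' ν
    rw [mul_comm]; exact Nat.mul_le_mul_left n (hS ν)
  refine ⟨fun ν => ?_, ?_⟩
  · show (torRed (fine_dvd n hM) b.1 ν - up n M' (torRed hM c) ν).val < S * n
    rw [hval]; exact hb.1 ν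
  · show (torRed (fine_dvd n hM) b.1 b.2 - up n M' (torRed hM c) b.2).val ≠ S * n - 1
    rw [hval]; exact hb.2

omit [∀ μ, NeZero (M' μ)] in
/-- interior bonds are cube bonds. [folklore] -/
theorem mem_cubeW_of_mem_intBonds {b : Tor (fine n M) × Fin (d + 1)} (hb : b ∈ intBonds M n c S) : b ∈ cubeW n c S :=
  (mem_cubeW b).mpr (blockOf_mem_cubeBlocks hb)

/-- ★ **THE TORUS DISTANCE ON THE CUBE IS READ EXACTLY THROUGH `π̃`**: for blocks `y, y′` of `□ + c` (side `S`, `2S ≤ M_ν`, `2S ≤ M′_ν`), `|π̃y − π̃y′|_{T′} = |y − y′|_T` — both are the box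
distance of the offsets. [folklore] -/
theorem tdistT_torRed_eq (hS2 : ∀ ν, 2 * S ≤ M ν) (hS2' : ∀ ν, 2 * S ≤ M' ν) {y y' : Tor M} (hy : y ∈ cubeBlocks M c S) (hy' : y' ∈ cubeBlocks M c S) :
    tdistT M' (torRed hM y) (torRed hM y') = tdistT M y y' := by
  rw [mem_cubeBlocks] at hy hy'
  have hS' : ∀ ν, S ≤ M' ν := fun ν => le_trans (Nat.le_mul_of_pos_left S two_pos) (hS2' ν)
  -- coordinatewise: both circular distances equal `|u − u′|` for the offsets `u, u′ < S`
  have hcoord : ∀ ν, circAbs (M' ν) (((torRed hM y ν).val : ℤ) - (torRed hM y' ν).val) = circAbs (M ν) (((y ν).val : ℤ) - (y' ν).val) := by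
    intro ν
    have hM1 : 1 ≤ M ν := Nat.pos_of_ne_zero (NeZero.ne _)
    have hM1' : 1 ≤ M' ν := Nat.pos_of_ne_zero (NeZero.ne _)
    set u : ℕ := ((y - c) ν).val with hu_def
    set u' : ℕ := ((y' - c) ν).val with hu'_def
    have hu : u < S := hy ν
    have hu' : u' < S := hy' ν
    -- big torus: `val y − val y′ = u − u′ + M k`
    obtain ⟨k₁, hk₁⟩ := exists_val_sub_eq (y ν) (c ν)
    obtain ⟨k₂, hk₂⟩ := exists_val_sub_eq (y' ν) (c ν)
    have e1 : ((y ν).val : ℤ) - (y' ν).val = ((u : ℤ) - u') + (M ν : ℤ) * (k₂ - k₁) := by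
      have a1 : ((u : ℕ) : ℤ) = ((y ν).val : ℤ) - (c ν).val + M ν * k₁ := by rw [hu_def, Pi.sub_apply]; exact hk₁
      have a2 : ((u' : ℕ) : ℤ) = ((y' ν).val : ℤ) - (c ν).val + M ν * k₂ := by rw [hu'_def, Pi.sub_apply]; exact hk₂
      linear_combination a2 - a1
    -- small torus: the offsets are the same numbers
    have v1 : (torRed hM (y - c) ν).val = u := val_torRed_of_lt hM (y - c) ν (lt_of_lt_of_le hu (hS' ν))
    have v2 : (torRed hM (y' - c) ν).val = u' := val_torRed_of_lt hM (y' - c) ν (lt_of_lt_of_le hu' (hS' ν))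
    obtain ⟨k₃, hk₃⟩ := exists_val_sub_eq (torRed hM y ν) (torRed hM c ν)
    obtain ⟨k₄, hk₄⟩ := exists_val_sub_eq (torRed hM y' ν) (torRed hM c ν)
    have e2 : ((torRed hM y ν).val : ℤ) - (torRed hM y' ν).val = ((u : ℤ) - u') + (M' ν : ℤ) * (k₄ - k₃) := by
      have a3 : ((u : ℕ) : ℤ) = ((torRed hM y ν).val : ℤ) - (torRed hM c ν).val + M' ν * k₃ := by
        rw [← v1, torRed_sub, Pi.sub_apply]; exact hk₃
      have a4 : ((u' : ℕ) : ℤ) = ((torRed hM y' ν).val : ℤ) - (torRed hM c ν).val + M' ν * k₄ := by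
        rw [← v2, torRed_sub, Pi.sub_apply]; exact hk₄
      linear_combination a4 - a3
    have habs : 2 * |(u : ℤ) - u'| ≤ 2 * S := by
      have : |(u : ℤ) - u'| ≤ S := abs_sub_le_iff.mpr ⟨by omega, by omega⟩
      linarith
    rw [e1, e2, circAbs_add_mul, circAbs_add_mul, circAbs_of_centred hM1' (habs.trans (by exact_mod_cast hS2' ν)),
      circAbs_of_centred hM1 (habs.trans (by exact_mod_cast hS2 ν))]
  unfold tdistT tdist
  congr 2
  funext ν
  rw [ccoord_toSite, ccoord_toSite, hcoord]

end CubeRed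

/-! ## §8 THE LIFTED NEUMANN CUBE PROPAGATOR on the big torus, its EXACT per-cube locality, and the transfer of block majorants through `π` -/

section Lift

open Literature.MathematicalPhysics.QuantumFieldTheory.Balaban1983to89.B6Prop26Gluing (mulOp mulOp_apply ind ind_nonneg ind_le_one)
open Literature.MathematicalPhysics.QuantumFieldTheory.Balaban1983to89.B6Prop26ReachTransplant (restrictOp extendOp transplant restrictOp_apply restrictOp_apply_of_injOn
  restrictOp_apply_of_not_mem extendOp_apply transplant_apply)
open Literature.MathematicalPhysics.QuantumFieldTheory.King1986.Torus (blockOf tdistT toSite)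
open Literature.MathematicalPhysics.QuantumFieldTheory.Balaban1983to89.B11SectG (BlockNorm HasMaj)
open Literature.MathematicalPhysics.QuantumFieldTheory.Balaban1983to89.B11AxialTransport190 (abs_le_loc_ofBlocks loc_ofBlocks_le)

variable (n : ℕ) [NeZero n] {M M' : Fin (d + 1) → ℕ} [∀ μ, NeZero (M μ)] [∀ μ, NeZero (M' μ)] (hM : ∀ μ, M' μ ∣ M μ) (c : Tor M) (S : ℕ) (a : ℝ)

/-- ★★★ **THE LIFTED NEUMANN CUBE PROPAGATOR** of the cube `□ + c` of side `S` on the BIG torus `Tor (fine n M)`: restrict the source to the cube's bonds, read it on the image cube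
`□′ + π̃c` of the SMALL torus `Tor (fine n M′)` (`M′ ∣ M`; for the doubled torus `M′_ν = 2S`), apply programme N's images propagator `G(□′) = Sym ∘ G′ ∘ χ°` there, pull back along `π`:
`G^{↑}(□ + c) := π^* ∘ G(□′ + π̃c) ∘ ρ_{W,π}` — the output is the `2S`-PERIODIC extension (NOT cut: exact locality below needs the uncut output). [cite: Balaban1984PropagatorsII, (2.37) p.229, p.238 (T_□), (2.90)–(2.91) p.239] -/
def liftCubeG : Module.End ℝ (Tor (fine n M) × Fin (d + 1) → ℝ) :=
  pullVR n hM ∘ₗ neumannCubeG M' n (torRed hM c) S a ∘ₗ restrictOp (cubeW n c S) (redBond n hM)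

/-- unfolding the lift at a bond. [folklore] -/
theorem liftCubeG_apply (f : Tor (fine n M) × Fin (d + 1) → ℝ) (b : Tor (fine n M) × Fin (d + 1)) :
    liftCubeG n hM c S a f b = neumannCubeG M' n (torRed hM c) S a (restrictOp (cubeW n c S) (redBond n hM) f) (redBond n hM b) := by
  obtain ⟨x, μ⟩ := b
  rw [liftCubeG, LinearMap.comp_apply, LinearMap.comp_apply, pullVR_apply]; rfl

/-- ★ **THE CUT LIFT IS THE TRANSPLANT**: `M_{χ_□} ∘ G^{↑}(□) = transplant W π G(□′)` (the lit's extension-by-zero ∘ local operator ∘ restriction). [cite: Balaban1984PropagatorsII, (2.90)–(2.91) p.239, (2.133) p.247] -/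
theorem mulOp_chiCube_comp_liftCubeG : mulOp (chiCube M n c S) ∘ₗ liftCubeG n hM c S a = transplant (cubeW n c S) (redBond n hM) (neumannCubeG M' n (torRed hM c) S a) := by
  refine LinearMap.ext fun f => funext fun b => ?_
  rw [LinearMap.comp_apply, mulOp_apply, liftCubeG_apply, transplant_apply, chiCube_eq_ite]
  split_ifs <;> simp

/-- the transplant does not see a cut by a multiplier equal to `1` on the image of the window. [folklore] -/
theorem transplant_mulOp_comp_of_eq_one {X X' : Type} [DecidableEq X] [DecidableEq X'] {W : Finset X} {e : X → X'} {χ : X' → ℝ} (hχ : ∀ x ∈ W, χ (e x) = 1)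
    (T : Module.End ℝ (X' → ℝ)) : transplant W e (mulOp χ ∘ₗ T) = transplant W e T := by
  refine LinearMap.ext fun f => funext fun x => ?_
  rw [transplant_apply, transplant_apply]
  by_cases hx : x ∈ W
  · rw [if_pos hx, if_pos hx, LinearMap.comp_apply, mulOp_apply, hχ x hx, one_mul]
  · rw [if_neg hx, if_neg hx]

/-- ★★★ **PER-CUBE LOCALITY OF THE LIFT, EXACT** (dag-n15-c FILE 45's `hloc` ON THE TORUS OF RECORD): for the doubled small torus `M′_ν = 2S`, `M′ ∣ M`, `n ≥ 1`, `a > 0` and every multiplier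
`h` supported on the interior bonds of `□ + c`: `M_h ∘ Δ_a^{M} ∘ G^{↑}(□ + c) = M_h` — by the DESCENT `Δ_a^{M} ∘ π^* = π^* ∘ Δ_a^{M′}` (P-Ib), programme N's locality on the small torus
(N-IIIa), and the injectivity of `π` on the cube. [cite: Balaban1984PropagatorsII, (2.37)–(2.38) p.229, (2.91) p.239; Balaban1984PropagatorsI, (1.69) p.29] -/
theorem mulOp_comp_deltaOp_comp_liftCubeG (hM2 : ∀ ν, M' ν = 2 * S) (hn : 1 ≤ n) (ha : 0 < a) {h : Tor (fine n M) × Fin (d + 1) → ℝ}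
    (hh : ∀ b, h b ≠ 0 → b ∈ intBonds M n c S) : mulOp h ∘ₗ deltaOp M n a ∘ₗ liftCubeG n hM c S a = mulOp h := by
  have hS : ∀ ν, S ≤ M' ν := fun ν => by rw [hM2 ν]; omega
  refine LinearMap.ext fun f => funext fun b => ?_
  rw [LinearMap.comp_apply, LinearMap.comp_apply, mulOp_apply, mulOp_apply]
  by_cases hb : h b = 0
  · rw [hb, zero_mul, zero_mul]
  have hbI : b ∈ intBonds M n c S := hh b hb
  have hbW : b ∈ cubeW n c S := mem_cubeW_of_mem_intBonds hbI
  obtain ⟨x, μ⟩ := b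
  rw [liftCubeG, LinearMap.comp_apply, LinearMap.comp_apply, deltaOp_pullVR_apply]
  -- programme N's locality on the small torus at the image bond
  have hloc' := congrFun (LinearMap.congr_fun (mulOp_chi_deltaOp_neumannCubeG M' n (torRed hM c) S a hM2 hn ha)
    (restrictOp (cubeW n c S) (redBond n hM) f)) (redBond n hM (x, μ))
  rw [LinearMap.comp_apply, LinearMap.comp_apply, mulOp_apply, mulOp_apply, chiInt_of_intBond (redBond_mem_intBonds hS hbI), one_mul, one_mul] at hloc'
  congr 1
  rw [show ((torRed (fine_dvd n hM) x, μ) : Tor (fine n M') × Fin (d + 1)) = redBond n hM (x, μ) from rfl, hloc',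
    restrictOp_apply_of_injOn (redBond_injOn_cubeW hS) f hbW]

/-- ★★ **THE MASTER TRANSFER LEMMA**: a block majorant of an operator `T′` on the SMALL lattice (geometry `g′`, blocks `blk′`) passes to the transplant `ε ∘ T′ ∘ ρ` on the BIG lattice
(geometry `g`, blocks `blk`) along a window `W` on which the chart `e` is injective and along a map of blocks `σ` with `blk′ ∘ e = σ ∘ blk` on `W`, the window's blocks lying in `B`:
the kernel is read at `(σy, σy′)` and carries the indicators of `B`.  (No injectivity of `σ` is needed.) [cite: Balaban1984PropagatorsII, (2.133) p.247 (shape), p.238 (T_□)] -/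
theorem hasMaj_transplant_of_blockMap {X X' : Type} [Fintype X] [Fintype X'] [DecidableEq X] [DecidableEq X'] {g g' : B6.Geometry} (blk : X → g.Site)
    (blk' : X' → g'.Site) (σ : g.Site → g'.Site) (W : Finset X) (e : X → X') (B : Set g.Site) (hblk : ∀ x ∈ W, blk' (e x) = σ (blk x))
    (hWB : ∀ x ∈ W, blk x ∈ B) (hinj : Set.InjOn e ↑W) {T' : Module.End ℝ (X' → ℝ)} {K' : g'.Site → g'.Site → ℝ} (hK' : ∀ a b, 0 ≤ K' a b)
    (hT : HasMaj (BlockNorm.ofBlocks g' blk') (BlockNorm.ofBlocks g' blk') T' K') :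
    HasMaj (BlockNorm.ofBlocks g blk) (BlockNorm.ofBlocks g blk) (transplant W e T') (fun y y' => ind B y * ind B y' * K' (σ y) (σ y')) := by
  classical
  intro y' μ hμ y
  dsimp only
  have hμ' : ∀ x, blk x ≠ y' → μ x = 0 := hμ
  have hloc0 : 0 ≤ (BlockNorm.ofBlocks g blk).loc y' μ := (BlockNorm.ofBlocks g blk).loc_nonneg y' μ
  by_cases hy' : y' ∈ B
  swap
  · -- the window misses the block of `y′`: the restriction vanishes
    have hρ : restrictOp W e μ = 0 := by
      funext x'
      rw [restrictOp_apply, Pi.zero_apply]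
      refine Finset.sum_eq_zero fun x hx => ?_
      rw [Finset.mem_filter] at hx
      exact hμ' x fun hb => hy' (hb ▸ hWB x hx.1)
    have h0 : transplant W e T' μ = 0 := by rw [transplant, LinearMap.comp_apply, LinearMap.comp_apply, hρ, map_zero, map_zero]
    rw [h0, (BlockNorm.ofBlocks g blk).loc_zero]
    exact mul_nonneg (mul_nonneg (mul_nonneg (ind_nonneg _ _) (ind_nonneg _ _)) (hK' _ _)) hloc0
  -- the restriction is localized at `σ y′` and no larger than `μ`
  have hloc'μ : (BlockNorm.ofBlocks g' blk').IsLoc (σ y') (restrictOp W e μ) := by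
    intro x' hx'
    rw [restrictOp_apply]
    refine Finset.sum_eq_zero fun x hx => ?_
    rw [Finset.mem_filter] at hx
    by_contra hne
    have hb : blk x = y' := by by_contra hb; exact hne (hμ' x hb)
    exact hx' (by rw [← hx.2, hblk x hx.1, hb])
  have hle : (BlockNorm.ofBlocks g' blk').loc (σ y') (restrictOp W e μ) ≤ (BlockNorm.ofBlocks g blk).loc y' μ := by
    refine loc_ofBlocks_le blk' _ hloc0 fun x' _ => ?_
    by_cases hex : ∃ x ∈ W, e x = x' ∧ μ x ≠ 0
    · obtain ⟨x, hxW, hxe, hxμ⟩ := hex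
      have hb : blk x = y' := by by_contra hb; exact hxμ (hμ' x hb)
      rw [← hxe, restrictOp_apply_of_injOn hinj μ hxW]
      exact abs_le_loc_ofBlocks blk μ hb
    · have h0 : restrictOp W e μ x' = 0 := by
        rw [restrictOp_apply]
        refine Finset.sum_eq_zero fun x hx => ?_
        rw [Finset.mem_filter] at hx
        by_contra hne
        exact hex ⟨x, hx.1, hx.2, hne⟩
      rw [h0, abs_zero]; exact (BlockNorm.ofBlocks g blk).loc_nonneg y' μ
  have h1 := hT (σ y') (restrictOp W e μ) hloc'μ (σ y)
  -- the output, read on the big lattice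
  have hout : (BlockNorm.ofBlocks g blk).loc y (transplant W e T' μ) ≤ ind B y * (BlockNorm.ofBlocks g' blk').loc (σ y) (T' (restrictOp W e μ)) := by
    refine loc_ofBlocks_le blk _ (mul_nonneg (ind_nonneg _ _) ((BlockNorm.ofBlocks g' blk').loc_nonneg _ _)) fun x hx => ?_
    rw [transplant_apply]
    by_cases hxW : x ∈ W
    · rw [if_pos hxW, show ind B y = 1 from by unfold ind; rw [if_pos (hx ▸ hWB x hxW)], one_mul]
      exact abs_le_loc_ofBlocks blk' _ (by rw [hblk x hxW, hx])
    · rw [if_neg hxW, abs_zero]; exact mul_nonneg (ind_nonneg _ _) ((BlockNorm.ofBlocks g' blk').loc_nonneg _ _)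
  rw [show ind B y' = 1 from by unfold ind; rw [if_pos hy'], mul_one]
  calc (BlockNorm.ofBlocks g blk).loc y (transplant W e T' μ) ≤ ind B y * (BlockNorm.ofBlocks g' blk').loc (σ y) (T' (restrictOp W e μ)) := hout
    _ ≤ ind B y * (K' (σ y) (σ y') * (BlockNorm.ofBlocks g blk).loc y' μ) :=
        mul_le_mul_of_nonneg_left (h1.trans (mul_le_mul_of_nonneg_left hle (hK' _ _))) (ind_nonneg _ _)
    _ = ind B y * K' (σ y) (σ y') * (BlockNorm.ofBlocks g blk).loc y' μ := by ring

end Lift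

end Summit.QuantumFields.YangMills.BalabanUVNodes.N15.TwoGrid

end
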